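import Literature.Topology.FourManifolds.DehnSurgeryTubularNbhdProofs
import HarnessLib

/-!
# Knots from regular simple closed curves on `S³`

Topic `Literature/Topology/FourManifolds` (trunk T-4MAN). A **constructor of knots**: a `C^∞`
`2π`-periodic curve `γ : ℝ → ℝ⁴` on the unit sphere with nowhere vanishing velocity, which is
injective modulo the period, defines a smooth knot `𝕊¹ ↪ 𝕊³` (`Literature.Topology.FourManifolds.Knot`, a `C^∞`
embedding in Mathlib's chart sense `Manifold.IsSmoothEmbedding (𝓡 1) (𝓡 3) ∞`) passing through
`γ θ` at `(cos θ, sin θ)`. This is the converse of the tree's `SphereEmbedding.curve`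
(`DehnSurgeryTubularNbhdProofs.lean`: a knot is a regular closed curve) and is the entry point for
building knots by explicit formulas (toolkit for the decomposition of
`Literature.Topology.FourManifolds.Knot.Schubert1949_normalPosition`, where band sums with prescribed arcs must be realised
as knots; also the missing ingredient of the named fact `isSmoothEmbedding_torusKnotMap`,
`KnotGroup.lean`). Everything here is proved:

* `Literature.Topology.FourManifolds.IsRegularClosedCurve γ` (structure, `Prop`): `γ` is `C^∞`, `2π`-periodic, unit length
  and regular (`γ' ≠ 0`);
* its normal framing `normal₁`, `normal₂` (the construction of `SphereEmbedding.normal₁/₂` of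
  `DehnSurgeryTubularNbhdProofs.lean`, which only uses regularity, repeated for curves: velocity
  coordinates in the quaternionic parallelisation, a pole off all velocity lines by Sard, two
  cross products), positively oriented (`frameDet_pos`), and Hirsch's tube
  `tube (θ, w) = (γ θ + w₀ N₁ θ + w₁ N₂ θ)/‖…‖` with injective differential on the zero section;
* `Literature.Topology.FourManifolds.IsRegularClosedCurve.toSphereMap` — the induced map `𝕊¹ → 𝕊³` (the zero section of
  the tree's `periodicLift` of the tube), with `toSphereMap (circlePoint θ) = γ θ`; it is smooth
  and an **immersion** (`isImmersion_toSphereMap`): the tube is a local diffeomorphism along the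
  zero section (`isLocalDiffeomorphAt_periodicLift`, inverse function theorem), and the zero
  section of a product neighbourhood is an immersion
  (`isImmersionAtOfComplement_of_eventuallyEq_prod`, `SmoothEmbeddingCriteria.lean`);
* `Literature.Topology.FourManifolds.IsRegularClosedCurve.toKnot` — if moreover `γ s = γ t` only when `(cos s, sin s) =
  (cos t, sin t)`, the induced map is injective on the compact circle, hence a topological
  embedding, hence a smooth embedding: a `Knot`, with `toKnot_apply_circlePoint`.

## References

* M. W. Hirsch, *Differential Topology*, GTM 33 (1976), Ch. 1 §3 (an injective immersion of a
  compact manifold is an embedding; Thm. 3.1), Ch. 4 §5, Thm. 5.1 (the tube `x + y` over a field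
  of transverse planes is a local diffeomorphism along the zero section). [Hirsch1976]
* R. H. Crowell, R. H. Fox, *Introduction to Knot Theory*, GTM 57, Ch. I §2 (differentiable
  knots as regular simple closed curves).

## Design notes

* The framing and tube are verbatim the constructions of `DehnSurgeryTubularNbhdProofs.lean`
  (there attached to a `SphereEmbedding 1 3`, here to a curve); that file is append-only and its
  definitions take a knot, so the curve-level copies are unavoidable. All statements are
  `[folklore]`.
* `toSphereMap`/`toKnot` take the proof `h : IsRegularClosedCurve γ` as an explicit argument
  (the pole of the framing is chosen from it).
-/

open scoped Manifold ContDiff Topology RealInnerProductSpace Matrix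
open Function Set Module

noncomputable section

namespace Literature.Topology.FourManifolds

/-- Local notation: `𝔼 n` is the model Euclidean space `EuclideanSpace ℝ (Fin n)`. -/
local notation "𝔼 " n:arg => EuclideanSpace ℝ (Fin n)

/-- Local notation: `𝕊 n` is the unit sphere in `EuclideanSpace ℝ (Fin (n + 1))`. -/
local notation "𝕊 " n:arg => (Metric.sphere (0 : EuclideanSpace ℝ (Fin (n + 1))) 1)

/-- Local notation: the model with corners of `𝕊¹ × ℝ²`. -/
local notation "𝓘₁₂" => (ModelWithCorners.prod (𝓡 1) 𝓘(ℝ, EuclideanSpace ℝ (Fin 2)))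

attribute [local instance] fact_finrank_euclideanSpace_two fact_finrank_euclideanSpace_four

/-- A **regular closed curve on `S³`**: a `C^∞`, `2π`-periodic map `γ : ℝ → ℝ⁴` with values on
the unit sphere and nowhere vanishing velocity (Crowell–Fox, Ch. I §2; Hirsch (1976), Ch. 1 §3:
an immersion of the circle). [folklore] -/
structure IsRegularClosedCurve (γ : ℝ → 𝔼 4) : Prop where
  /-- The curve is `C^∞`. -/
  contDiff : ContDiff ℝ ∞ γ
  /-- The curve is `2π`-periodic. -/
  periodic : Periodic γ (2 * Real.pi)
  /-- The curve lies on the unit sphere. -/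
  norm_eq_one : ∀ θ, ‖γ θ‖ = 1
  /-- The curve is regular: its velocity never vanishes. -/
  deriv_ne_zero : ∀ θ, deriv γ θ ≠ 0

namespace IsRegularClosedCurve

variable {γ : ℝ → 𝔼 4} (h : IsRegularClosedCurve γ)
include h

/-! ### Velocity -/

/-- The curve is differentiable. [folklore] -/
theorem differentiable : Differentiable ℝ γ := h.contDiff.differentiable (by simp)

/-- The curve is continuous. [folklore] -/
theorem continuous : Continuous γ := h.contDiff.continuous

/-- The curve has derivative its velocity. [folklore] -/
theorem hasDerivAt (θ : ℝ) : HasDerivAt γ (deriv γ θ) θ := (h.differentiable θ).hasDerivAt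

/-- The velocity is smooth. [folklore] -/
theorem contDiff_deriv : ContDiff ℝ ∞ (deriv γ) := (contDiff_infty_iff_deriv.1 h.contDiff).2

/-- The velocity is `2π`-periodic. [folklore] -/
theorem periodic_deriv : Periodic (deriv γ) (2 * Real.pi) := fun θ ↦ by
  rw [← deriv_comp_add_const]
  congr 1
  funext t
  exact h.periodic t

/-- The velocity is tangent to the sphere: `⟪γ', γ⟫ = 0`. [folklore] -/
theorem inner_deriv_self (θ : ℝ) : ⟪deriv γ θ, γ θ⟫ = 0 := by
  have h1 := (h.hasDerivAt θ).norm_sq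
  have hconst : (fun t ↦ ‖γ t‖ ^ 2) = fun _ ↦ (1 : ℝ) := by
    funext t; rw [h.norm_eq_one, one_pow]
  rw [hconst] at h1
  have := (hasDerivAt_const θ (1 : ℝ)).unique h1
  rw [real_inner_comm]
  linarith

/-! ### The normal framing (as in `DehnSurgeryTubularNbhdProofs.lean`, Part I) -/

omit h in
/-- The coordinates of the velocity in the parallelisation `(X₁ γ, X₂ γ, X₃ γ)` of `T_γ 𝕊³`.
[folklore] -/
def frameVec (_h : IsRegularClosedCurve γ) (θ : ℝ) : Fin 3 → ℝ := frameCoords (γ θ) (deriv γ θ)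

/-- The velocity is the frame combination of its coordinates. [folklore] -/
theorem deriv_eq_frameComb (θ : ℝ) : deriv γ θ = frameComb (γ θ) (h.frameVec θ) :=
  eq_frameComb_frameCoords (h.norm_eq_one θ) (h.inner_deriv_self θ)

/-- The coordinates of the velocity never vanish. [folklore] -/
theorem frameVec_ne_zero (θ : ℝ) : h.frameVec θ ≠ 0 := fun h0 ↦ h.deriv_ne_zero θ (by
  rw [h.deriv_eq_frameComb θ, h0]
  ext j
  simp)

/-- The coordinates of the velocity are smooth. [folklore] -/
theorem contDiff_frameVec : ContDiff ℝ ∞ h.frameVec :=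
  contDiff_frameCoords h.contDiff h.contDiff_deriv

/-- The coordinates of the velocity are `2π`-periodic. [folklore] -/
theorem periodic_frameVec : Periodic h.frameVec (2 * Real.pi) := fun θ ↦ by
  simp only [frameVec, h.periodic θ, h.periodic_deriv θ]

/-- There is a direction nowhere parallel to the velocity coordinates (Sard). [folklore] -/
theorem exists_forall_frameVec_cross_ne_zero : ∃ e : Fin 3 → ℝ, ∀ θ, h.frameVec θ ⨯₃ e ≠ 0 :=
  exists_forall_cross_ne_zero (h.contDiff_frameVec.of_le (by simp)) h.frameVec_ne_zero

omit h in
/-- A chosen direction nowhere parallel to the velocity coordinates. [folklore] -/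
def pole (h : IsRegularClosedCurve γ) : Fin 3 → ℝ :=
  Classical.choose h.exists_forall_frameVec_cross_ne_zero

/-- The defining property of `pole`. [folklore] -/
theorem frameVec_cross_pole_ne_zero (θ : ℝ) : h.frameVec θ ⨯₃ h.pole ≠ 0 :=
  Classical.choose_spec h.exists_forall_frameVec_cross_ne_zero θ

omit h in
/-- Frame coordinates `v × e` of the first normal vector. [folklore] -/
def normalCoords₁ (h : IsRegularClosedCurve γ) (θ : ℝ) : Fin 3 → ℝ := h.frameVec θ ⨯₃ h.pole

omit h in
/-- Frame coordinates `v × (v × e)` of the second normal vector. [folklore] -/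
def normalCoords₂ (h : IsRegularClosedCurve γ) (θ : ℝ) : Fin 3 → ℝ :=
  h.frameVec θ ⨯₃ h.normalCoords₁ θ

/-- Orientation of the framing in coordinates: `det (v, v × e, v × (v × e)) > 0`. [folklore] -/
theorem det_frameVec_normalCoords_pos (θ : ℝ) :
    0 < Matrix.det ![h.frameVec θ, h.normalCoords₁ θ, h.normalCoords₂ θ] :=
  det_cross_cross_pos (h.frameVec_cross_pole_ne_zero θ)

/-- The first normal coordinates are smooth. [folklore] -/
theorem contDiff_normalCoords₁ : ContDiff ℝ ∞ h.normalCoords₁ :=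
  contDiff_cross h.contDiff_frameVec contDiff_const

/-- The second normal coordinates are smooth. [folklore] -/
theorem contDiff_normalCoords₂ : ContDiff ℝ ∞ h.normalCoords₂ :=
  contDiff_cross h.contDiff_frameVec h.contDiff_normalCoords₁

/-- The first normal coordinates are `2π`-periodic. [folklore] -/
theorem periodic_normalCoords₁ : Periodic h.normalCoords₁ (2 * Real.pi) := fun θ ↦ by
  simp only [normalCoords₁, h.periodic_frameVec θ]

/-- The second normal coordinates are `2π`-periodic. [folklore] -/
theorem periodic_normalCoords₂ : Periodic h.normalCoords₂ (2 * Real.pi) := fun θ ↦ by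
  simp only [normalCoords₂, h.periodic_frameVec θ, h.periodic_normalCoords₁ θ]

omit h in
/-- The first normal vector field `N₁ = Σᵢ (v × e)ᵢ Xᵢ γ` along the curve. [folklore] -/
def normal₁ (h : IsRegularClosedCurve γ) (θ : ℝ) : 𝔼 4 := frameComb (γ θ) (h.normalCoords₁ θ)

omit h in
/-- The second normal vector field `N₂ = Σᵢ (v × (v × e))ᵢ Xᵢ γ` along the curve. [folklore] -/
def normal₂ (h : IsRegularClosedCurve γ) (θ : ℝ) : 𝔼 4 := frameComb (γ θ) (h.normalCoords₂ θ)

/-- The first normal field is smooth. [folklore] -/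
theorem contDiff_normal₁ : ContDiff ℝ ∞ h.normal₁ := contDiff_frameComb h.contDiff h.contDiff_normalCoords₁

/-- The second normal field is smooth. [folklore] -/
theorem contDiff_normal₂ : ContDiff ℝ ∞ h.normal₂ := contDiff_frameComb h.contDiff h.contDiff_normalCoords₂

/-- The first normal field is `2π`-periodic. [folklore] -/
theorem periodic_normal₁ : Periodic h.normal₁ (2 * Real.pi) := fun θ ↦ by
  simp only [normal₁, h.periodic θ, h.periodic_normalCoords₁ θ]

/-- The second normal field is `2π`-periodic. [folklore] -/
theorem periodic_normal₂ : Periodic h.normal₂ (2 * Real.pi) := fun θ ↦ by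
  simp only [normal₂, h.periodic θ, h.periodic_normalCoords₂ θ]

/-- The first normal field is orthogonal to the position vector. [folklore] -/
theorem inner_normal₁_self (θ : ℝ) : ⟪h.normal₁ θ, γ θ⟫ = 0 := inner_frameComb_left _ _

/-- The second normal field is orthogonal to the position vector. [folklore] -/
theorem inner_normal₂_self (θ : ℝ) : ⟪h.normal₂ θ, γ θ⟫ = 0 := inner_frameComb_left _ _

/-- **The framing is positively oriented**: `det (γ, γ', N₁, N₂) > 0`. [folklore] -/
theorem frameDet_pos (θ : ℝ) : 0 < frameDet (γ θ) (deriv γ θ) (h.normal₁ θ) (h.normal₂ θ) := by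
  rw [h.deriv_eq_frameComb θ, normal₁, normal₂, frameDet_frameComb, h.norm_eq_one]
  simpa using h.det_frameVec_normalCoords_pos θ

/-! ### Hirsch's tube over the curve (as in `DehnSurgeryTubularNbhdProofs.lean`, Part II) -/

omit h in
/-- The un-normalised tube `(θ, w) ↦ γ θ + w₀ N₁ θ + w₁ N₂ θ ∈ ℝ⁴`. [folklore] -/
def tubeRaw (h : IsRegularClosedCurve γ) (q : ℝ × 𝔼 2) : 𝔼 4 :=
  γ q.1 + q.2 0 • h.normal₁ q.1 + q.2 1 • h.normal₂ q.1

/-- Unfolding of `tubeRaw`. [folklore] -/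
theorem tubeRaw_apply (θ : ℝ) (w : 𝔼 2) :
    h.tubeRaw (θ, w) = γ θ + w 0 • h.normal₁ θ + w 1 • h.normal₂ θ := rfl

/-- The un-normalised tube has unit component along the position vector. [folklore] -/
theorem inner_tubeRaw_self (θ : ℝ) (w : 𝔼 2) : ⟪h.tubeRaw (θ, w), γ θ⟫ = 1 := by
  rw [tubeRaw_apply, inner_add_left, inner_add_left, inner_smul_left, inner_smul_left,
    h.inner_normal₁_self, h.inner_normal₂_self, real_inner_self_eq_norm_sq, h.norm_eq_one]
  simp

/-- The un-normalised tube never vanishes. [folklore] -/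
theorem tubeRaw_ne_zero (q : ℝ × 𝔼 2) : h.tubeRaw q ≠ 0 := by
  obtain ⟨θ, w⟩ := q
  intro h0
  have := h.inner_tubeRaw_self θ w
  rw [h0, inner_zero_left] at this
  exact zero_ne_one this

/-- The norm of the un-normalised tube never vanishes. [folklore] -/
theorem norm_tubeRaw_ne_zero (q : ℝ × 𝔼 2) : ‖h.tubeRaw q‖ ≠ 0 :=
  norm_ne_zero_iff.2 (h.tubeRaw_ne_zero q)

/-- The un-normalised tube is smooth. [folklore] -/
theorem contDiff_tubeRaw : ContDiff ℝ ∞ h.tubeRaw := by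
  have h0 : ContDiff ℝ ∞ fun q : ℝ × 𝔼 2 ↦ q.2 0 :=
    (EuclideanSpace.proj (0 : Fin 2) : 𝔼 2 →L[ℝ] ℝ).contDiff.comp contDiff_snd
  have h1 : ContDiff ℝ ∞ fun q : ℝ × 𝔼 2 ↦ q.2 1 :=
    (EuclideanSpace.proj (1 : Fin 2) : 𝔼 2 →L[ℝ] ℝ).contDiff.comp contDiff_snd
  exact ((h.contDiff.comp contDiff_fst).add (h0.smul (h.contDiff_normal₁.comp contDiff_fst))).add
    (h1.smul (h.contDiff_normal₂.comp contDiff_fst))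

/-- On the zero section the un-normalised tube is the curve. [folklore] -/
theorem tubeRaw_zero (θ : ℝ) : h.tubeRaw (θ, 0) = γ θ := by
  simp [tubeRaw_apply]

/-- The un-normalised tube is `2π`-periodic in `θ`. [folklore] -/
theorem tubeRaw_add_two_pi (θ : ℝ) (w : 𝔼 2) : h.tubeRaw (θ + 2 * Real.pi, w) = h.tubeRaw (θ, w) := by
  rw [tubeRaw_apply, tubeRaw_apply, h.periodic θ, h.periodic_normal₁ θ, h.periodic_normal₂ θ]

/-- The un-normalised tube along the first fibre axis. [folklore] -/
theorem tubeRaw_single_zero (θ s : ℝ) :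
    h.tubeRaw (θ, EuclideanSpace.single 0 s) = γ θ + s • h.normal₁ θ := by
  simp [tubeRaw_apply]

/-- The un-normalised tube along the second fibre axis. [folklore] -/
theorem tubeRaw_single_one (θ s : ℝ) :
    h.tubeRaw (θ, EuclideanSpace.single 1 s) = γ θ + s • h.normal₂ θ := by
  simp [tubeRaw_apply]

omit h in
/-- **The tube map** `(θ, w) ↦ (γ θ + w₀ N₁ θ + w₁ N₂ θ)/‖…‖ ∈ 𝕊³ ⊆ ℝ⁴` (Hirsch (1976), §4.5,
Thm. 5.1 and proof of Thm. 5.2). [folklore] -/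
def tube (h : IsRegularClosedCurve γ) (q : ℝ × 𝔼 2) : 𝔼 4 := ‖h.tubeRaw q‖⁻¹ • h.tubeRaw q

/-- Unfolding of `tube`. [folklore] -/
theorem tube_def (q : ℝ × 𝔼 2) : h.tube q = ‖h.tubeRaw q‖⁻¹ • h.tubeRaw q := rfl

/-- The tube map takes values in the unit sphere. [folklore] -/
theorem norm_tube (q : ℝ × 𝔼 2) : ‖h.tube q‖ = 1 := by
  rw [tube_def, norm_smul, norm_inv, norm_norm, inv_mul_cancel₀ (h.norm_tubeRaw_ne_zero q)]

/-- The tube map is smooth. [folklore] -/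
theorem contDiff_tube : ContDiff ℝ ∞ h.tube :=
  ((h.contDiff_tubeRaw.norm ℝ h.tubeRaw_ne_zero).inv h.norm_tubeRaw_ne_zero).smul h.contDiff_tubeRaw

/-- The tube map is differentiable. [folklore] -/
theorem differentiable_tube : Differentiable ℝ h.tube := h.contDiff_tube.differentiable (by simp)

/-- On the zero section the tube map is the curve. [folklore] -/
theorem tube_zero (θ : ℝ) : h.tube (θ, 0) = γ θ := by
  rw [tube_def, tubeRaw_zero, h.norm_eq_one, inv_one, one_smul]

/-- The tube map is `2π`-periodic in `θ`. [folklore] -/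
theorem tube_add_two_pi (θ : ℝ) (w : 𝔼 2) : h.tube (θ + 2 * Real.pi, w) = h.tube (θ, w) := by
  rw [tube_def, tube_def, tubeRaw_add_two_pi]

/-- The `θ`-derivative of the tube map on the zero section is the velocity. [folklore] -/
theorem fderiv_tube_zero_fst (θ : ℝ) : fderiv ℝ h.tube (θ, 0) (1, 0) = deriv γ θ := by
  rw [← deriv_fst_eq_fderiv (h.differentiable_tube _)]
  simp only [tube_zero]

/-- The fibre derivatives of the tube map on the zero section are the normal fields up to a
multiple of the position vector. [folklore] -/
theorem fderiv_tube_zero_snd (θ : ℝ) {i : Fin 2} {N : 𝔼 4}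
    (hN : ∀ s : ℝ, h.tubeRaw (θ, EuclideanSpace.single i s) = γ θ + s • N) :
    ∃ c : ℝ, fderiv ℝ h.tube (θ, 0) (0, EuclideanSpace.single i 1) = c • γ θ + N := by
  have hR : HasDerivAt (fun s : ℝ ↦ γ θ + s • N) N 0 := by
    simpa using ((hasDerivAt_id (0 : ℝ)).smul_const N).const_add (γ θ)
  have hR0' : (fun s : ℝ ↦ γ θ + s • N) 0 ≠ 0 := by
    intro h0
    have := h.norm_eq_one θ
    simp only [zero_smul, add_zero] at h0
    rw [h0, norm_zero] at this
    exact zero_ne_one this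
  have hn : HasDerivAt (fun s : ℝ ↦ ‖γ θ + s • N‖) (deriv (fun s : ℝ ↦ ‖γ θ + s • N‖) 0) 0 :=
    (hR.differentiableAt.norm ℝ hR0').hasDerivAt
  have hinv := hn.fun_inv (by rw [zero_smul, add_zero, h.norm_eq_one]; exact one_ne_zero)
  have hprod := hinv.fun_smul hR
  refine ⟨-deriv (fun s : ℝ ↦ ‖γ θ + s • N‖) 0 / ‖γ θ + (0 : ℝ) • N‖ ^ 2, ?_⟩
  rw [← deriv_snd_eq_fderiv (h.differentiable_tube _)]
  have hfun : (fun s ↦ h.tube (θ, 0 + EuclideanSpace.single i s)) =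
      fun s ↦ ‖γ θ + s • N‖⁻¹ • (γ θ + s • N) := by
    funext s; rw [zero_add, tube_def, hN]
  rw [hfun, hprod.deriv, zero_smul, add_zero, h.norm_eq_one, inv_one, one_smul, add_comm]

/-- The Jacobian frame determinant of the tube map on the zero section is the framing
determinant. [folklore] -/
theorem tubeFrameDet_tube_zero (θ : ℝ) :
    tubeFrameDet h.tube (θ, 0) = frameDet (γ θ) (deriv γ θ) (h.normal₁ θ) (h.normal₂ θ) := by
  obtain ⟨c₁, h₁⟩ := h.fderiv_tube_zero_snd θ (i := 0) (h.tubeRaw_single_zero θ)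
  obtain ⟨c₂, h₂⟩ := h.fderiv_tube_zero_snd θ (i := 1) (h.tubeRaw_single_one θ)
  rw [tubeFrameDet_def, fderiv_tube_zero_fst, h₁, h₂, tube_zero, frameDet_add_smul]

/-- **The differential of the tube map is injective on the zero section.** [folklore] -/
theorem fderiv_tube_zero_injective (θ : ℝ) : Injective (fderiv ℝ h.tube (θ, 0)) :=
  fderiv_injective_of_tubeFrameDet_ne_zero (by rw [tubeFrameDet_tube_zero]; exact (h.frameDet_pos θ).ne')

/-! ### The induced map `𝕊¹ → 𝕊³` -/

omit h in
/-- **The map `𝕊¹ → 𝕊³` induced by a regular closed curve**: the zero section of the tube map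
lifted to the circle (`periodicLift`), i.e. `u ↦ γ θ` for any angle `θ` of `u`. [folklore] -/
def toSphereMap (h : IsRegularClosedCurve γ) (u : 𝕊 1) : 𝕊 3 :=
  periodicLift h.tube h.norm_tube (u, 0)

/-- The induced map passes through `γ θ` at `(cos θ, sin θ)`. [folklore] -/
@[simp] theorem coe_toSphereMap_circlePoint (θ : ℝ) :
    ((h.toSphereMap (circlePoint θ) : 𝕊 3) : 𝔼 4) = γ θ := by
  rw [toSphereMap, coe_periodicLift_circlePoint h.tube_add_two_pi h.norm_tube, tube_zero]

/-- The induced map is smooth. [folklore] -/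
theorem contMDiff_toSphereMap : ContMDiff (𝓡 1) (𝓡 3) ∞ h.toSphereMap :=
  (contMDiff_periodicLift h.contDiff_tube h.tube_add_two_pi h.norm_tube).comp
    (contMDiff_id.prodMk contMDiff_const)

/-- The induced map is continuous. [folklore] -/
theorem continuous_toSphereMap : Continuous h.toSphereMap := h.contMDiff_toSphereMap.continuous

/-- **The induced map is an immersion at every point** (with normal complement `ℝ²`): the tube
is a local diffeomorphism at `(u, 0)` (`isLocalDiffeomorphAt_periodicLift`: injective
differential and the inverse function theorem), and the zero section of a product neighbourhood
is an immersion (`isImmersionAtOfComplement_of_eventuallyEq_prod`). Hirsch (1976), Ch. 4 §5,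
Thm. 5.1; Ch. 1 §3. [folklore] -/
theorem isImmersionAtOfComplement_toSphereMap (u : 𝕊 1) :
    Manifold.IsImmersionAtOfComplement (𝔼 2) (𝓡 1) (𝓡 3) ∞ h.toSphereMap u := by
  obtain ⟨e, hpe, heq⟩ := isLocalDiffeomorphAt_periodicLift h.contDiff_tube h.tube_add_two_pi
    h.norm_tube (p := (u, (0 : 𝔼 2))) (fun t _ ↦ h.fderiv_tube_zero_injective t)
  refine isImmersionAtOfComplement_of_eventuallyEq_prod e.toOpenPartialHomeomorph
    e.contMDiffOn_toFun e.contMDiffOn_invFun (ContinuousLinearEquiv.ofFinrankEq finrank_model_prod_eq)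
    hpe ?_
  have hopen : IsOpen ((fun y : 𝕊 1 ↦ ((y, (0 : 𝔼 2)) : (𝕊 1) × 𝔼 2)) ⁻¹' e.source) :=
    e.open_source.preimage (by fun_prop)
  filter_upwards [hopen.mem_nhds hpe] with y hy
  exact heq hy

/-- The induced map is an immersion. [folklore] -/
theorem isImmersion_toSphereMap : Manifold.IsImmersion (𝓡 1) (𝓡 3) ∞ h.toSphereMap :=
  Manifold.IsImmersionOfComplement.isImmersion (F := 𝔼 2) h.isImmersionAtOfComplement_toSphereMap

/-- If `γ` identifies only parameters with the same point on the circle, the induced map is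
injective. [folklore] -/
theorem injective_toSphereMap (hinj : ∀ s t, γ s = γ t → circlePoint s = circlePoint t) :
    Injective h.toSphereMap := by
  intro u v huv
  obtain ⟨s, rfl⟩ := circlePoint_surjective u
  obtain ⟨t, rfl⟩ := circlePoint_surjective v
  apply hinj
  rw [← h.coe_toSphereMap_circlePoint s, ← h.coe_toSphereMap_circlePoint t, huv]

/-- An injective induced map is a smooth embedding (an injective immersion of the compact circle;
Hirsch (1976), Ch. 1 §3). [folklore] -/
theorem isSmoothEmbedding_toSphereMap (hinj : ∀ s t, γ s = γ t → circlePoint s = circlePoint t) :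
    Manifold.IsSmoothEmbedding (𝓡 1) (𝓡 3) ∞ h.toSphereMap :=
  ⟨h.isImmersion_toSphereMap,
    (h.continuous_toSphereMap.isClosedEmbedding (h.injective_toSphereMap hinj)).isEmbedding⟩

omit h in
/-- **The knot defined by a regular simple closed curve on `S³`**: a `C^∞`, `2π`-periodic,
regular curve `γ` on the unit sphere which is injective modulo `2π` defines a smooth knot
`𝕊¹ ↪ 𝕊³` through `γ θ` at `(cos θ, sin θ)` (Crowell–Fox, Ch. I §2: differentiable knots;
Hirsch (1976), Ch. 1 §3). [folklore] -/
def toKnot (h : IsRegularClosedCurve γ) (hinj : ∀ s t, γ s = γ t → circlePoint s = circlePoint t) :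
    Knot :=
  ⟨h.toSphereMap, h.isSmoothEmbedding_toSphereMap hinj⟩

/-- The knot of a regular simple closed curve as a function. [folklore] -/
@[simp] theorem coe_toKnot (hinj : ∀ s t, γ s = γ t → circlePoint s = circlePoint t) :
    ⇑(h.toKnot hinj) = h.toSphereMap := rfl

/-- The knot of a regular simple closed curve passes through `γ θ` at `(cos θ, sin θ)`. [folklore] -/
theorem coe_toKnot_circlePoint (hinj : ∀ s t, γ s = γ t → circlePoint s = circlePoint t) (θ : ℝ) :
    ((h.toKnot hinj (circlePoint θ) : 𝕊 3) : 𝔼 4) = γ θ :=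
  h.coe_toSphereMap_circlePoint θ

/-- The range of the knot of a regular simple closed curve, read in `ℝ⁴`, is the range of the
curve. [folklore] -/
theorem image_coe_range_toKnot (hinj : ∀ s t, γ s = γ t → circlePoint s = circlePoint t) :
    (Subtype.val : (𝕊 3) → 𝔼 4) '' range (h.toKnot hinj) = range γ := by
  ext p
  simp only [mem_image, mem_range]
  constructor
  · rintro ⟨x, ⟨u, rfl⟩, rfl⟩
    obtain ⟨θ, rfl⟩ := circlePoint_surjective u
    exact ⟨θ, (h.coe_toKnot_circlePoint hinj θ).symm⟩
  · rintro ⟨θ, rfl⟩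
    exact ⟨h.toKnot hinj (circlePoint θ), ⟨_, rfl⟩, h.coe_toKnot_circlePoint hinj θ⟩

end IsRegularClosedCurve

/-- **A knot is the knot of its own curve**: the curve `SphereEmbedding.curve K` of a knot is a
regular closed curve (`DehnSurgeryTubularNbhdProofs.lean`). [folklore] -/
theorem SphereEmbedding.isRegularClosedCurve_curve (K : Knot) : IsRegularClosedCurve K.curve where
  contDiff := K.contDiff_curve
  periodic := K.periodic_curve
  norm_eq_one := K.norm_curve
  deriv_ne_zero := K.tangent_ne_zero

end Literature.Topology.FourManifolds
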